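import Literature.Computability.AlgebraicComplexity.OracleComplexity
import Literature.Computability.AlgebraicComplexity.ValiantConjectureEquivProofs
import HarnessLib

/-!
# Bürgisser 2024, §3.3: "Valiant's conjecture `VP ≠ VNP` just expresses that there is more than
# one c-degree" — PROOF

Topic `Computability/AlgebraicComplexity`. Cell `val-lit`, row Bur2024-A (P. Bürgisser,
*Completeness classes in algebraic complexity theory*, arXiv:2406.06217, 2024; held text
`paper:arxiv-2406.06217`, p0014 L7–L10):

> We call two p-families `(f_n)` and `(g_m)` *c-equivalent* iff they are c-reductions of each
> other. The c-degrees, defined as c-equivalence classes of p-definable families, form a partially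
> ordered set with respect to c-reduction. Valiant's conjecture `VP ≠ VNP` just expresses that
> there is more than one c-degree.

With the tree's c-reduction `IsCReduction` (`OracleComplexity.lean`; Bürgisser 1999, Def. 5.2 —
a quasi-order: `IsCReduction.refl`, `IsCReduction.trans`) and the classes `VP k ⊆ VNP k` of
bundled families (`ValiantClasses.lean`, `VP_subset_VNP_holds`):

* `IsCEquivalent` — c-equivalence of two families (both c-reductions hold);
* `isCReduction_of_isPComputable` — a p-computable family c-reduces to every family (ignore the
  oracle: `L^g(f) ≤ L(f)`), so all `VP` families are c-equivalent (`isCEquivalent_of_isVPFamily`);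
* `vp_ne_vnp_iff_exists_not_isCEquivalent` — **`VP k ≠ VNP k` iff there are two p-definable
  families over `k` that are not c-equivalent** (i.e. more than one c-degree): if `VP ≠ VNP`, a
  family `F ∈ VNP ∖ VP` is not c-equivalent to the zero family (`VP` is closed downwards under
  `≤_c`, `IsVPFamily.of_isCReduction`); if `VP = VNP`, all p-definable families are p-computable,
  hence pairwise c-equivalent.

Theorems (and one definition with body) only; no named facts, no `sorry` (D-0026). Over an
arbitrary commutative semiring `k` (the survey: a field). Honest framing: a reformulation of the
conjecture, not progress on it; `VP ≠ VNP` is NOT proved.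
-/

namespace Literature.Computability.AlgebraicComplexity

open MvPolynomial

universe u v w

section CEquivalence

variable {k : Type u} [CommSemiring k] {σ : ℕ → Type v} {τ : ℕ → Type w}

/-- **c-equivalence** (Bürgisser 2024, §3.3): two families are c-equivalent iff they are
c-reductions of each other. [cite: Burgisser2024Completeness, §3.3] -/
def IsCEquivalent (f : ∀ n, MvPolynomial (σ n) k) (g : ∀ n, MvPolynomial (τ n) k) : Prop :=
  IsCReduction f g ∧ IsCReduction g f

/-- Unfolding of `IsCEquivalent`. [cite: Burgisser2024Completeness, §3.3] -/
theorem isCEquivalent_iff (f : ∀ n, MvPolynomial (σ n) k) (g : ∀ n, MvPolynomial (τ n) k) :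
    IsCEquivalent f g ↔ IsCReduction f g ∧ IsCReduction g f :=
  Iff.rfl

/-- c-equivalence is reflexive. [cite: Burgisser2024Completeness, §3.3] -/
theorem IsCEquivalent.refl (f : ∀ n, MvPolynomial (σ n) k) : IsCEquivalent f f :=
  ⟨IsCReduction.refl f, IsCReduction.refl f⟩

/-- c-equivalence is symmetric. [cite: Burgisser2024Completeness, §3.3] -/
theorem IsCEquivalent.symm {f : ∀ n, MvPolynomial (σ n) k} {g : ∀ n, MvPolynomial (τ n) k}
    (h : IsCEquivalent f g) : IsCEquivalent g f :=
  ⟨h.2, h.1⟩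

/-- **A p-computable family c-reduces to every family** (`t = id`, ignore the oracle:
`L^{g_n}(f_n) ≤ L(f_n)`; Bürgisser 1999, §5: `VP` is the least c-degree). [cite: Burgisser1999, Rem. 5.5] -/
theorem isCReduction_of_isPComputable {f : ∀ n, MvPolynomial (σ n) k} (hf : IsPComputable f)
    (g : ∀ n, MvPolynomial (τ n) k) : IsCReduction f g :=
  ⟨_root_.id, IsPBounded.id, hf.mono fun n => oracleComplexity_le_complexity (g n) (f n)⟩

/-- Two `VP` families are c-equivalent (the c-degree of `VP`). [cite: Burgisser1999, Rem. 5.5] -/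
theorem isCEquivalent_of_isVPFamily [∀ n, Fintype (σ n)] [∀ n, Fintype (τ n)]
    {f : ∀ n, MvPolynomial (σ n) k} {g : ∀ n, MvPolynomial (τ n) k} (hf : IsVPFamily f)
    (hg : IsVPFamily g) : IsCEquivalent f g :=
  ⟨isCReduction_of_isPComputable hf.2 g, isCReduction_of_isPComputable hg.2 f⟩

end CEquivalence

section Classes

variable (k : Type u) [CommSemiring k]

/-- The zero family (no variables, `f_n = 0`), a member of `VP`. [cite: Burgisser2000, Def. 2.4] -/
noncomputable def PolyFamily.zero : PolyFamily k where
  nvars _ := 0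
  poly _ := 0

/-- The zero family is in `VP`. [cite: Burgisser2000, Def. 2.4] -/
theorem PolyFamily.zero_mem_VP : PolyFamily.zero k ∈ VP k := by
  refine ⟨⟨(IsPBounded.const 0).mono fun n => ?_, (IsPBounded.const 0).mono fun n => ?_⟩,
    (IsPBounded.const 0).mono fun n => ?_⟩
  · simp [PolyFamily.zero]
  · simp [PolyFamily.zero]
  · show complexity (0 : MvPolynomial (Fin 0) k) ≤ 0
    rw [← C_0, complexity_C_holds]

/-- The zero family is in `VNP`. [cite: Burgisser2000, §2.1] -/
theorem PolyFamily.zero_mem_VNP : PolyFamily.zero k ∈ VNP k :=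
  VP_subset_VNP_holds k (PolyFamily.zero_mem_VP k)

/-- **Bürgisser 2024, §3.3: "Valiant's conjecture `VP ≠ VNP` just expresses that there is more
than one c-degree."** `VP k ≠ VNP k` iff there are two p-definable families over `k` that are not
c-equivalent. (`⇒`: a family in `VNP ∖ VP` does not c-reduce to the zero family, `VP` being closed
downwards under `≤_c` among p-families; `⇐`: if `VP = VNP` all p-definable families are
p-computable, hence pairwise c-equivalent.) [cite: Burgisser2024Completeness, §3.3] -/
theorem vp_ne_vnp_iff_exists_not_isCEquivalent :
    VP k ≠ VNP k ↔ ∃ F ∈ VNP k, ∃ G ∈ VNP k, ¬ IsCEquivalent F.poly G.poly := by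
  constructor
  · intro hne
    have hsub : VP k ⊆ VNP k := VP_subset_VNP_holds k
    obtain ⟨F, hFVNP, hFVP⟩ : ∃ F ∈ VNP k, F ∉ VP k := by
      by_contra hall
      push Not at hall
      exact hne (Set.Subset.antisymm hsub fun F hF => hall F hF)
    refine ⟨F, hFVNP, PolyFamily.zero k, PolyFamily.zero_mem_VNP k, fun hce => hFVP ?_⟩
    have hF : IsVNPFamily F.poly := hFVNP
    exact IsVPFamily.of_isCReduction hF.1 hce.1 (PolyFamily.zero_mem_VP k)
  · rintro ⟨F, hF, G, hG, hne⟩ heq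
    rw [← heq] at hF hG
    exact hne (isCEquivalent_of_isVPFamily hF hG)

end Classes

end Literature.Computability.AlgebraicComplexity
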